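/-
Copyright (c) 2026 the pub-hodgecm-mathlib formalisation cell (harness21).  Prover seat hodgecm-mathlib-K2Liu-p14 (g2): Track B «K2-LIT»,
hLiu418 = stmt-HodgeConjecture-24832; LEAD F0P6-plan (g13) RULING M-157b (β4)∕(β5) + 09:48:19Z (3) «(β4-iv) CM-arch instantiation from ★ (β5)», file (β4-iv) A.
-/
import Literature.NumberTheory.Automorphic.MixedSpaceUnitsMellinProduct        -- ★ `integrable_and_integral_units_prod_mul_norm_cpow` (`∫_{K_∞ˣ}` of place tensors)
import Literature.NumberTheory.Weil1964.ArchFollandFrameGen                     -- ★ `scaledFrameGen` (a real frame of `(Fin 2 → mixedSpace L)`)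
import Literature.Analysis.SegalBargmann.SchwartzBargmannIntertwining           -- ★ `hermiteSchwartzPi` (polynomial × Gaussian Schwartz maps on `ℝ^σ`)
import Mathlib.NumberTheory.NumberField.InfinitePlace.TotallyRealComplex
import Mathlib.Algebra.MvPolynomial.Monad
import HarnessLib

/-!
# Crux `HLiu418`, road `K2_Liu`, Road Φ organ G5 (β) «Godement sections exhaust», file (β4-iv) A:
# MONOMIAL × GAUSSIAN SCHWARTZ DATA ON `K_∞² = (Fin 2 → mixedSpace L)` AND THEIR ARCHIMEDEAN GODEMENT INTEGRALS (totally complex `L`)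

Cell `hodgecm-mathlib`, crux item hLiu418 = `stmt-HodgeConjecture-24832`; prover K2Liu-p14 (g2).  THEOREMS ONLY (no `def`, no instance, no notation,
no named-fact hypothesis, no `sorry`); lane `--supports stmt-HodgeConjecture-24832` (count-neutral helper).  `L` a TOTALLY COMPLEX number field (Mathlib
`NumberField.IsTotallyComplex`; every CM field), so `K_∞ = mixedSpace L = ℝ^∅ × ℂ^{r₂}` and a vector `y : Fin 2 → mixedSpace L` has the complex coordinates
`y_{v,l} = (y l).2 v`, `(v, l) : V := {v // IsComplex v} × Fin 2`.  These are the archimedean data of ★ (β4-iii) `K2LiuGL2GodementSectionsExhaustGlobal.exists_godement_exhaust`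
(its `hK`∕`hgi`∕`hAinv` faces), the multi-place twin of ★ (β5) `K2LiuGL2GodementSectionOfFlatArch`:
* §1 **`exists_schwartzMap_eval_mul_gaussian`** — for every polynomial `p(y, ȳ)` in the `2r₂` complex coordinates and their conjugates, the function
  `y ↦ p(y, ȳ) · e^{−2π Σ_{v,l} |y_{v,l}|²}` IS a Mathlib `SchwartzMap` on the real vector space `Fin 2 → mixedSpace L` (★ `hermiteSchwartzPi` on `ℝ^{FrameIdx}`
  transported along the ★ real frame `scaledFrameGen` scaled by `√2`, Mathlib `SchwartzMap.compCLMOfContinuousLinearEquiv`) — no estimate is redone;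
* §2 the ARCHIMEDEAN GODEMENT INTEGRAL of a monomial datum at a row with unit components: for a Haar measure `μ` on `K_∞ˣ` there is `c_μ > 0` with
  **`∫_{K_∞ˣ} Φ_m(x · r) N(x)^w dμ(x) = c_μ · ∏_v [π (2π)^{−(w + a_v)} Γ(w + a_v)] · (c r^m)`**, the integrand integrable, for every monomial `m` of bidegree `(a_v, a_v)`
  at each place `v`, `0 < re w` (indeed `0 < re (w + a_v)`), `Φ_m(y) = c y^m e^{−2π|y|²}` and `|r_{0,v}|² + |r_{1,v}|² = 1` (`exists_integral_monomial_gaussian`):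
  the integrand is the PLACE TENSOR `(c r^m) · ∏_v (|x_v|²)^{a_v} e^{−2π|x_v|²} · N(x)^{(w+½)−½}`, ★ `MixedSpaceUnitsMellinProduct.integrable_and_integral_units_prod_mul_norm_cpow`
  (`d^×x = c_μ dx∕N(x)`, Fubini) and Tate's complex integral ★ `integral_complex_normSq_cpow_mul_exp` (`∫_ℂ (|z|²)^{a−1} e^{−b|z|²} = π b^{−a} Γ(a)`); the factors
  `π (2π)^{−(w+a)} Γ(w+a)` never vanish for `re(w+a) > 0` and their inverses are ENTIRE (`gammaFactorC_ne_zero`, `differentiable_gammaFactorC_inv`).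
[cite: Tate1950, §2.5 (k complex)] [cite: CasselsFrohlichANT1967, Ch. XV §2.5, §4.3] [cite: JacquetLanglands1970, §6, proof of Thm. 11.1 p. 173] [cite: Bump1997, §3.7].
HONEST LABEL.  `HC_CM` is proved only modulo the 7 printed citations (2 remaining named inputs: hLiu418 = `stmt-HodgeConjecture-24832`,
h413 = `stmt-HodgeConjecture-24833`) until rung 0 closes.
-/

set_option autoImplicit false
set_option linter.dupNamespace false -- the mandated namespace repeats `HodgeConjecture.HodgeConjecture`

noncomputable section

open MeasureTheory Measure NumberField NumberField.InfinitePlace NumberField.mixedEmbedding Set Complex MvPolynomial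
open scoped NNReal ENNReal Classical ComplexConjugate Real
open Literature.NumberTheory.Automorphic Literature.NumberTheory.Weil1964 Literature.Analysis.SegalBargmann

namespace Summit.HodgeConjecture.HodgeConjecture.Cruxes.HLiu418.K2LiuMixedSpaceGodementMonomials

variable {L : Type} [Field L] [NumberField L]

/-! ## §0 Totally complex fields have no real place -/

omit [NumberField L] in
/-- a totally complex number field has no real place. [folklore] -/
theorem isEmpty_isReal [IsTotallyComplex L] : IsEmpty {w : InfinitePlace L // w.IsReal} :=
  ⟨fun w => (not_isReal_iff_isComplex.2 (IsTotallyComplex.isComplex w.1)) w.2⟩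

/-! ## §1 Polynomial × Gaussian Schwartz maps on `Fin 2 → mixedSpace L` -/

section Schwartz

/-- `re² + im² = |z|²` in `ℂ`-valued form. [folklore] -/
theorem ofReal_re_sq_add_im_sq (z : ℂ) : ((z.re : ℝ) : ℂ) ^ 2 + ((z.im : ℝ) : ℂ) ^ 2 = ((‖z‖ ^ 2 : ℝ) : ℂ) := by
  rw [← Complex.normSq_eq_norm_sq, Complex.normSq_apply]
  push_cast
  ring

/-- `(√2)⁻¹ · (re(√2 z) + i·im(√2 z)) = z`. [folklore] -/
theorem sqrt_two_inv_mul_re_add_im (z : ℂ) :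
    ((Real.sqrt 2 : ℝ) : ℂ)⁻¹ * ((((Real.sqrt 2 : ℝ) : ℂ) * z).re + (((((Real.sqrt 2 : ℝ) : ℂ) * z).im : ℝ) : ℂ) * I) = z := by
  rw [Complex.re_add_im, ← mul_assoc, inv_mul_cancel₀ (by exact_mod_cast (Real.sqrt_pos.2 two_pos).ne'), one_mul]

/-- `(√2)⁻¹ · (re(√2 z) − i·im(√2 z)) = z̄`. [folklore] -/
theorem sqrt_two_inv_mul_re_sub_im (z : ℂ) :
    ((Real.sqrt 2 : ℝ) : ℂ)⁻¹ * ((((Real.sqrt 2 : ℝ) : ℂ) * z).re - (((((Real.sqrt 2 : ℝ) : ℂ) * z).im : ℝ) : ℂ) * I) = conj z := by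
  have h : ((((Real.sqrt 2 : ℝ) : ℂ) * z).re : ℂ) - (((((Real.sqrt 2 : ℝ) : ℂ) * z).im : ℝ) : ℂ) * I = conj (((Real.sqrt 2 : ℝ) : ℂ) * z) :=
    Complex.ext (by simp) (by simp)
  rw [h, map_mul, Complex.conj_ofReal, ← mul_assoc, inv_mul_cancel₀ (by exact_mod_cast (Real.sqrt_pos.2 two_pos).ne'), one_mul]

/-- `re(√2 z)² + im(√2 z)² = 2|z|²`. [folklore] -/
theorem re_sq_add_im_sq_sqrt_two_mul (z : ℂ) :
    (((((Real.sqrt 2 : ℝ) : ℂ) * z).re : ℝ) : ℂ) ^ 2 + (((((Real.sqrt 2 : ℝ) : ℂ) * z).im : ℝ) : ℂ) ^ 2 = 2 * ((‖z‖ ^ 2 : ℝ) : ℂ) := by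
  rw [ofReal_re_sq_add_im_sq, norm_mul, mul_pow, Complex.norm_real, Real.norm_eq_abs, abs_of_nonneg (Real.sqrt_nonneg _),
    Real.sq_sqrt zero_le_two]
  push_cast
  ring

variable [IsTotallyComplex L]

/-- **POLYNOMIAL × GAUSSIAN IS SCHWARTZ ON `K_∞²`.**  For every polynomial `p` in the complex coordinates `y_{v,l} = (y l).2 v` of `y : Fin 2 → mixedSpace L`
(`inl (v,l)`) and their conjugates (`inr (v,l)`), the function `y ↦ p(y, ȳ) · exp(−2π Σ_{v,l} |y_{v,l}|²)` is a `SchwartzMap` on the real vector space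
`Fin 2 → mixedSpace L`: it is ★ `hermiteSchwartzPi (bind₁ θ p)` (`q(x) e^{−π|x|²}` on `ℝ^{FrameIdx}`) composed with the ★ real frame `scaledFrameGen` scaled by
`√2` (coordinates `re(√2 y_{v,l})`, `im(√2 y_{v,l})`; no real place).  [cite: Tate1950, §2.5] [cite: JacquetLanglands1970, §6] -/
theorem exists_schwartzMap_eval_mul_gaussian (p : MvPolynomial (({v : InfinitePlace L // v.IsComplex} × Fin 2) ⊕ ({v : InfinitePlace L // v.IsComplex} × Fin 2)) ℂ) :
    ∃ Φ : SchwartzMap (Fin 2 → mixedSpace L) ℂ, ∀ y : Fin 2 → mixedSpace L,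
      Φ y = eval (Sum.elim (fun vl : {v : InfinitePlace L // v.IsComplex} × Fin 2 => (y vl.2).2 vl.1)
          (fun vl : {v : InfinitePlace L // v.IsComplex} × Fin 2 => conj ((y vl.2).2 vl.1))) p *
        cexp (-2 * π * ∑ vl : {v : InfinitePlace L // v.IsComplex} × Fin 2, ((‖(y vl.2).2 vl.1‖ ^ 2 : ℝ) : ℂ)) := by
  haveI : IsEmpty {w : InfinitePlace L // w.IsReal} := isEmpty_isReal
  have hs2 : ((Real.sqrt 2 : ℝ) : ℂ) ≠ 0 := by exact_mod_cast (Real.sqrt_pos.2 two_pos).ne'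
  -- the real frame, scaled by `√2` at the complex places
  set e : (Fin 2 → mixedSpace L) ≃L[ℝ] (FrameIdx L (Fin 2) → ℝ) :=
    scaledFrameGen L (Fin 2) (fun _ => (1 : ℝ)) (fun _ => one_ne_zero) (fun _ => ((Real.sqrt 2 : ℝ) : ℂ)) (fun _ => hs2) with he
  -- the substitution `y_{v,l} = (√2)⁻¹ (X_re + i X_im)`, `ȳ_{v,l} = (√2)⁻¹ (X_re − i X_im)`
  set θ : ({v : InfinitePlace L // v.IsComplex} × Fin 2) ⊕ ({v : InfinitePlace L // v.IsComplex} × Fin 2) → MvPolynomial (FrameIdx L (Fin 2)) ℂ :=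
    Sum.elim (fun vl => C (((Real.sqrt 2 : ℝ) : ℂ)⁻¹) * (X (Sum.inr (Sum.inl vl.2, vl.1)) + X (Sum.inr (Sum.inr vl.2, vl.1)) * C I))
      (fun vl => C (((Real.sqrt 2 : ℝ) : ℂ)⁻¹) * (X (Sum.inr (Sum.inl vl.2, vl.1)) - X (Sum.inr (Sum.inr vl.2, vl.1)) * C I)) with hθ
  refine ⟨SchwartzMap.compCLMOfContinuousLinearEquiv ℂ e (hermiteSchwartzPi (bind₁ θ p)), fun y => ?_⟩
  rw [SchwartzMap.compCLMOfContinuousLinearEquiv_apply, Function.comp_apply, hermiteSchwartzPi_apply, hermiteFun, Literature.NumberTheory.Automorphic.eval_bind₁]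
  have hsub : (fun i => eval (fun k => ((e y k : ℝ) : ℂ)) (θ i)) =
      Sum.elim (fun vl : {v : InfinitePlace L // v.IsComplex} × Fin 2 => (y vl.2).2 vl.1)
        (fun vl : {v : InfinitePlace L // v.IsComplex} × Fin 2 => conj ((y vl.2).2 vl.1)) := by
    funext vl
    rcases vl with ⟨v, l⟩ | ⟨v, l⟩
    · simp only [hθ, Sum.elim_inl, map_mul, map_add, eval_C, eval_X, he, scaledFrameGen_apply_inr_inl, scaledFrameGen_apply_inr_inr]
      exact sqrt_two_inv_mul_re_add_im _
    · simp only [hθ, Sum.elim_inr, map_mul, map_sub, eval_C, eval_X, he, scaledFrameGen_apply_inr_inl, scaledFrameGen_apply_inr_inr]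
      exact sqrt_two_inv_mul_re_sub_im _
  rw [hsub]
  congr 1
  · -- the Gaussian: `Σ_k (e y)_k² = 2 Σ_{v,l} |y_{v,l}|²`
    rw [gauss]
    congr 1
    rw [Fintype.sum_sum_type, Fintype.sum_empty, zero_add, Fintype.sum_prod_type, Fintype.sum_sum_type, ← Finset.sum_add_distrib,
      Fintype.sum_prod_type_right, Finset.mul_sum]
    simp only [he, scaledFrameGen_apply_inr_inl, scaledFrameGen_apply_inr_inr]
    rw [Finset.mul_sum]
    refine Finset.sum_congr rfl fun l _ => ?_
    rw [← Finset.sum_add_distrib, Finset.mul_sum, Finset.mul_sum]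
    refine Finset.sum_congr rfl fun v _ => ?_
    rw [re_sq_add_im_sq_sqrt_two_mul]
    ring

end Schwartz

/-! ## §2 The archimedean Godement integral of a monomial datum at a row with unit components -/

section Godement

/-- the complex Γ-factor `π (2π)^{−a} Γ(a)` does not vanish for `re a > 0`. [cite: Tate1950, §2.5] -/
theorem gammaFactorC_ne_zero {a : ℂ} (ha : 0 < a.re) : (π : ℂ) * ((1 / ((2 * π : ℝ) : ℂ)) ^ a * Complex.Gamma a) ≠ 0 := by
  refine mul_ne_zero (by exact_mod_cast Real.pi_ne_zero) (mul_ne_zero (fun h => ?_) (Complex.Gamma_ne_zero_of_re_pos ha))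
  have h2 := (cpow_eq_zero_iff _ _).1 h
  exact (div_ne_zero one_ne_zero (by exact_mod_cast Real.two_pi_pos.ne') : (1 / ((2 * π : ℝ) : ℂ)) ≠ 0) h2.1

/-- the inverse Γ-factor `w ↦ [π (2π)^{−(w+a)} Γ(w+a)]⁻¹ = π⁻¹ (2π)^{w+a} Γ(w+a)⁻¹` is ENTIRE (`1∕Γ` is entire). [cite: Tate1950, §2.5] -/
theorem differentiable_gammaFactorC_inv (a : ℂ) :
    Differentiable ℂ fun w : ℂ => ((π : ℂ) * ((1 / ((2 * π : ℝ) : ℂ)) ^ (w + a) * Complex.Gamma (w + a)))⁻¹ := by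
  have hb : (1 / ((2 * π : ℝ) : ℂ)) ≠ 0 := div_ne_zero one_ne_zero (by exact_mod_cast Real.two_pi_pos.ne')
  have heq : (fun w : ℂ => ((π : ℂ) * ((1 / ((2 * π : ℝ) : ℂ)) ^ (w + a) * Complex.Gamma (w + a)))⁻¹) =
      fun w : ℂ => (π : ℂ)⁻¹ * ((1 / ((2 * π : ℝ) : ℂ)) ^ (-(w + a)) * (Complex.Gamma (w + a))⁻¹) := by
    funext w
    rw [mul_inv, mul_inv, Complex.cpow_neg]
  rw [heq]
  refine (Differentiable.mul (fun w => ?_) (Complex.differentiable_one_div_Gamma.comp (differentiable_id.add_const _))).const_mul _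
  exact (differentiableAt_id.add_const _).neg.const_cpow (Or.inl hb)

/-- the value of a monomial `c · Π y^{m_inl} ȳ^{m_inr}` at a point, written as a product over all variables. [folklore] -/
theorem eval_monomial_eq_prod {σ : Type*} [Fintype σ] (m : (σ ⊕ σ) →₀ ℕ) (c : ℂ) (f : σ ⊕ σ → ℂ) :
    eval f (monomial m c) = c * ((∏ i : σ, f (Sum.inl i) ^ m (Sum.inl i)) * ∏ i : σ, f (Sum.inr i) ^ m (Sum.inr i)) := by
  rw [eval_monomial, Finsupp.prod_fintype _ _ (fun n => pow_zero _), Fintype.prod_sum_type]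

variable [IsTotallyComplex L]

/-- **THE ARCHIMEDEAN GODEMENT INTEGRAL OF A MONOMIAL × GAUSSIAN AT A ROW WITH UNIT COMPONENTS** (the multi-place twin of ★ (β5)
`integral_godement_monomial`, in the `μ_∞`-currency of ★ (β4-iii)).  For a Haar measure `μ` on `K_∞ˣ` there is `c_μ > 0` such that: for every monomial `m`
in `(y, ȳ)` of bidegree `(a_v, a_v)` at EACH complex place `v` (`Σ_l m (inl (v,l)) = Σ_l m (inr (v,l)) = a_v`), every `c`, every `w` with `0 < re w`, every row
`r : Fin 2 → mixedSpace L` with unit components (`|r_{0,v}|² + |r_{1,v}|² = 1`, e.g. the bottom row of `k ∈ K_∞ = ∏_v U(2)`), and every function `Φ` with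
`Φ(y) = c y^m e^{−2π|y|²}`, the function `x ↦ Φ(x · r) N(x)^w` is `μ`-integrable on `K_∞ˣ` and
  `∫_{K_∞ˣ} Φ(x · r) N(x)^w dμ(x) = (c_μ · ∏_v π (2π)^{−(w+a_v)} Γ(w+a_v)) · (c r^m)`
— `Φ(x · r) = (c r^m) ∏_v (|x_v|²)^{a_v} e^{−2π|x_v|²}`, ★ `integrable_and_integral_units_prod_mul_norm_cpow` (`s = w + ½`), ★ `integral_complex_normSq_cpow_mul_exp`.
[cite: Tate1950, §2.5 (k complex)] [cite: JacquetLanglands1970, §6, p. 173] [cite: CasselsFrohlichANT1967, Ch. XV §4.3] -/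
theorem exists_integral_monomial_gaussian (μ : Measure (mixedSpace L)ˣ) [μ.IsHaarMeasure] :
    ∃ cμ : ℝ, 0 < cμ ∧ ∀ (m : (({v : InfinitePlace L // v.IsComplex} × Fin 2) ⊕ ({v : InfinitePlace L // v.IsComplex} × Fin 2)) →₀ ℕ)
      (a : {v : InfinitePlace L // v.IsComplex} → ℕ), (∀ v, ∑ l, m (Sum.inl (v, l)) = a v) → (∀ v, ∑ l, m (Sum.inr (v, l)) = a v) →
      ∀ (c w : ℂ), 0 < w.re → ∀ (r : Fin 2 → mixedSpace L), (∀ v, ‖(r 0).2 v‖ ^ 2 + ‖(r 1).2 v‖ ^ 2 = 1) →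
      ∀ (Φ : (Fin 2 → mixedSpace L) → ℂ), (∀ y, Φ y =
        eval (Sum.elim (fun vl : {v : InfinitePlace L // v.IsComplex} × Fin 2 => (y vl.2).2 vl.1)
          (fun vl : {v : InfinitePlace L // v.IsComplex} × Fin 2 => conj ((y vl.2).2 vl.1))) (monomial m c) *
        cexp (-2 * π * ∑ vl : {v : InfinitePlace L // v.IsComplex} × Fin 2, ((‖(y vl.2).2 vl.1‖ ^ 2 : ℝ) : ℂ))) →
      Integrable (fun x : (mixedSpace L)ˣ => Φ (fun l => (x : mixedSpace L) * r l) * ((mixedEmbedding.norm ((x : (mixedSpace L)ˣ) : mixedSpace L) : ℝ) : ℂ) ^ w) μ ∧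
      ∫ x : (mixedSpace L)ˣ, Φ (fun l => (x : mixedSpace L) * r l) * ((mixedEmbedding.norm ((x : (mixedSpace L)ˣ) : mixedSpace L) : ℝ) : ℂ) ^ w ∂μ =
        ((cμ : ℂ) * ∏ v, ((π : ℂ) * ((1 / ((2 * π : ℝ) : ℂ)) ^ (w + a v) * Complex.Gamma (w + a v)))) *
          eval (Sum.elim (fun vl : {v : InfinitePlace L // v.IsComplex} × Fin 2 => (r vl.2).2 vl.1)
            (fun vl : {v : InfinitePlace L // v.IsComplex} × Fin 2 => conj ((r vl.2).2 vl.1))) (monomial m c) := by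
  haveI : IsEmpty {w : InfinitePlace L // w.IsReal} := isEmpty_isReal
  obtain ⟨cμ, hcμ, H⟩ := integrable_and_integral_units_prod_mul_norm_cpow L μ
  refine ⟨cμ, hcμ, fun m a hma hma' c w hw r hr Φ hΦ => ?_⟩
  -- the local functions `G_v(z) = (|z|²)^{a_v} e^{−2π|z|²}` (no real place: `F` is vacuous)
  set G : {v : InfinitePlace L // v.IsComplex} → ℂ → ℂ :=
    fun v z => ((‖z‖ ^ 2 : ℝ) : ℂ) ^ (a v) * cexp (-((2 * π : ℝ) : ℂ) * ((‖z‖ ^ 2 : ℝ) : ℂ)) with hG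
  set F : {w : InfinitePlace L // w.IsReal} → ℝ → ℂ := fun _ _ => 1 with hF
  set E : ℂ := eval (Sum.elim (fun vl : {v : InfinitePlace L // v.IsComplex} × Fin 2 => (r vl.2).2 vl.1)
    (fun vl : {v : InfinitePlace L // v.IsComplex} × Fin 2 => conj ((r vl.2).2 vl.1))) (monomial m c) with hE
  -- KEY pointwise identity: `Φ(x · r) N(x)^w = E · (∏ F ∏ G)(x) · N(x)^{(w+½)−½}`
  have hpt : ∀ x : (mixedSpace L)ˣ, Φ (fun l => (x : mixedSpace L) * r l) * ((mixedEmbedding.norm ((x : (mixedSpace L)ˣ) : mixedSpace L) : ℝ) : ℂ) ^ w =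
      E * (((∏ w', F w' (((x : (mixedSpace L)ˣ) : mixedSpace L).1 w')) * ∏ v, G v (((x : (mixedSpace L)ˣ) : mixedSpace L).2 v)) *
        ((mixedEmbedding.norm ((x : (mixedSpace L)ˣ) : mixedSpace L) : ℝ) : ℂ) ^ (w + 1 / 2 - 1 / 2)) := by
    intro x
    have hF1 : (∏ w', F w' (((x : (mixedSpace L)ˣ) : mixedSpace L).1 w')) = 1 := Fintype.prod_empty _
    -- split the monomial at `x · r` into its `x`-part and its `r`-part
    have hinl : (∏ vl : {v : InfinitePlace L // v.IsComplex} × Fin 2,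
        Sum.elim (fun vl : {v : InfinitePlace L // v.IsComplex} × Fin 2 => ((fun l => (x : mixedSpace L) * r l) vl.2).2 vl.1)
          (fun vl : {v : InfinitePlace L // v.IsComplex} × Fin 2 => conj (((fun l => (x : mixedSpace L) * r l) vl.2).2 vl.1)) (Sum.inl vl) ^ m (Sum.inl vl)) =
        (∏ vl : {v : InfinitePlace L // v.IsComplex} × Fin 2, ((x : mixedSpace L).2 vl.1) ^ m (Sum.inl vl)) *
          ∏ vl : {v : InfinitePlace L // v.IsComplex} × Fin 2, ((r vl.2).2 vl.1) ^ m (Sum.inl vl) := by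
      rw [← Finset.prod_mul_distrib]
      exact Finset.prod_congr rfl fun vl _ => by rw [Sum.elim_inl, ← mul_pow]; rfl
    have hinr : (∏ vl : {v : InfinitePlace L // v.IsComplex} × Fin 2,
        Sum.elim (fun vl : {v : InfinitePlace L // v.IsComplex} × Fin 2 => ((fun l => (x : mixedSpace L) * r l) vl.2).2 vl.1)
          (fun vl : {v : InfinitePlace L // v.IsComplex} × Fin 2 => conj (((fun l => (x : mixedSpace L) * r l) vl.2).2 vl.1)) (Sum.inr vl) ^ m (Sum.inr vl)) =
        (∏ vl : {v : InfinitePlace L // v.IsComplex} × Fin 2, conj ((x : mixedSpace L).2 vl.1) ^ m (Sum.inr vl)) *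
          ∏ vl : {v : InfinitePlace L // v.IsComplex} × Fin 2, conj ((r vl.2).2 vl.1) ^ m (Sum.inr vl) := by
      rw [← Finset.prod_mul_distrib]
      exact Finset.prod_congr rfl fun vl _ => by rw [Sum.elim_inr, ← mul_pow, ← map_mul]; rfl
    -- the `x`-powers collect to `(|x_v|²)^{a_v}`
    have hxpow : (∏ vl : {v : InfinitePlace L // v.IsComplex} × Fin 2, ((x : mixedSpace L).2 vl.1) ^ m (Sum.inl vl)) *
        ∏ vl : {v : InfinitePlace L // v.IsComplex} × Fin 2, conj (((x : mixedSpace L).2 vl.1)) ^ m (Sum.inr vl) =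
        ∏ v, ((‖(x : mixedSpace L).2 v‖ ^ 2 : ℝ) : ℂ) ^ (a v) := by
      rw [Fintype.prod_prod_type, Fintype.prod_prod_type, ← Finset.prod_mul_distrib]
      refine Finset.prod_congr rfl fun v _ => ?_
      simp only []
      rw [Finset.prod_pow_eq_pow_sum, Finset.prod_pow_eq_pow_sum, hma v, hma' v, ← mul_pow, Complex.mul_conj, Complex.normSq_eq_norm_sq]
    -- the Gaussian at `x · r` is `∏_v e^{−2π|x_v|²}` (unit rows)
    have hgauss : cexp (-2 * π * ∑ vl : {v : InfinitePlace L // v.IsComplex} × Fin 2,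
        ((‖((fun l => (x : mixedSpace L) * r l) vl.2).2 vl.1‖ ^ 2 : ℝ) : ℂ)) =
        ∏ v, cexp (-((2 * π : ℝ) : ℂ) * ((‖(x : mixedSpace L).2 v‖ ^ 2 : ℝ) : ℂ)) := by
      rw [← Complex.exp_sum, Finset.mul_sum, Fintype.sum_prod_type]
      congr 1
      refine Finset.sum_congr rfl fun v _ => ?_
      simp only [Fin.sum_univ_two, Pi.mul_apply, Prod.snd_mul, norm_mul, mul_pow]
      push_cast
      have h1 : ((‖(r 0).2 v‖ : ℂ)) ^ 2 + ((‖(r 1).2 v‖ : ℂ)) ^ 2 = 1 := by exact_mod_cast hr v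
      linear_combination (-2 * (π : ℂ) * ((‖(x : mixedSpace L).2 v‖ : ℂ)) ^ 2) * h1
    rw [add_sub_cancel_right, hΦ, hE, eval_monomial_eq_prod, eval_monomial_eq_prod, hF1, one_mul, hinl, hinr, hgauss]
    simp only [Sum.elim_inl, Sum.elim_inr, hG]
    rw [Finset.prod_mul_distrib, ← hxpow]
    ring
  -- the one-variable integrals: `∫_ℂ G_v(z) (|z|²)^{w−1} = π (2π)^{−(w+a_v)} Γ(w+a_v)` (and integrability from the non-zero value)
  have hloc : ∀ v, (∫ z : ℂ, G v z * ((‖z‖ ^ 2 : ℝ) : ℂ) ^ (w + 1 / 2 - 3 / 2)) =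
      (π : ℂ) * ((1 / ((2 * π : ℝ) : ℂ)) ^ (w + a v) * Complex.Gamma (w + a v)) := by
    intro v
    have hwa : 0 < (w + a v).re := by simp only [add_re, natCast_re]; linarith [(Nat.cast_nonneg (a v) : (0 : ℝ) ≤ a v)]
    rw [← integral_complex_normSq_cpow_mul_exp hwa Real.two_pi_pos]
    refine integral_congr_ae ?_
    have h0 : ∀ᵐ z : ℂ ∂volume, z ≠ 0 := by simp [ae_iff]
    filter_upwards [h0] with z hz
    have hq : (((‖z‖ ^ 2 : ℝ)) : ℂ) ≠ 0 := by exact_mod_cast (pow_pos (norm_pos_iff.2 hz) 2).ne'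
    simp only [hG]
    rw [show w + 1 / 2 - 3 / 2 = w - 1 by ring, show w + (a v : ℂ) - 1 = (a v : ℂ) + (w - 1) by ring, Complex.cpow_add _ _ hq,
      Complex.cpow_natCast]
    ring
  have hlocint : ∀ v, Integrable (fun z : ℂ => G v z * ((‖z‖ ^ 2 : ℝ) : ℂ) ^ (w + 1 / 2 - 3 / 2)) := by
    intro v
    by_contra h
    have h0 := integral_undef h
    rw [hloc v] at h0
    exact gammaFactorC_ne_zero (by simp only [add_re, natCast_re]; linarith [(Nat.cast_nonneg (a v) : (0 : ℝ) ≤ a v)]) h0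
  have hGm : ∀ v, Measurable (G v) := fun v =>
    (((Complex.continuous_ofReal.comp (continuous_norm.pow 2)).pow _).mul
      (Complex.continuous_exp.comp (continuous_const.mul (Complex.continuous_ofReal.comp (continuous_norm.pow 2))))).measurable
  obtain ⟨hint, hval⟩ := H F G (w + 1 / 2) (fun _ => measurable_const) hGm (fun w' => isEmptyElim w') hlocint
  simp_rw [hpt]
  refine ⟨hint.const_mul E, ?_⟩
  rw [integral_const_mul, hval, Fintype.prod_empty, one_mul, Finset.prod_congr rfl fun v _ => hloc v]
  ring

end Godement

end Summit.HodgeConjecture.HodgeConjecture.Cruxes.HLiu418.K2LiuMixedSpaceGodementMonomials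

end
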